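import Mathlib.Data.Fintype.Pi
import Literature.Computability.MetaComplexity.BlockClosure
import Literature.Computability.MetaComplexity.ResLinRankStrategy
import Literature.Computability.MetaComplexity.ResLinWidthLifting
import HarnessLib

/-!
# The binary pigeonhole principle requires Res(⊕) rank `> n/4` (Efremenko–Garlík–Itsykson 2024, Thm 5.5)

The binary pigeonhole principle `BPHPᵐₙ`, `n = 2^ℓ` [Efremenko–Garlík–Itsykson, STOC 2024, §2.5]:
pigeon `x < m` is described by the `ℓ` bits `x·ℓ + j` (`j < ℓ`) of its hole, and for every two
pigeons `x < y` and every hole `h ∈ {0,1}^ℓ` there is the clause "pigeon `x` is not in `h` or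
pigeon `y` is not in `h`" (`bphpCNF m ℓ`, width `2ℓ`). **Theorem 5.5** of Efremenko–Garlík–Itsykson:
*every Res(⊕) refutation of `BPHPᵐₙ` contains a linear clause `C` with `rk(¬C) ≥ n/4`* — "all
previously known lower bounds on width/rank were based on polynomial calculus degree lower bounds,
hence they were very indirect". We prove (`lt_resLinWidth_bphp`): for `ℓ ≥ 3` and every `m`, every
Res(⊕) refutation (resolution rule + SEMANTIC weakening) of `bphpCNF m ℓ` has a line of rank
`> 2^(ℓ-2) = n/4`.

Proof (the paper's §5 strategy with a DETERMINISTIC extension step). The family of LOCALLY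
CONSISTENT systems [EGI24 §5: "a solution that sends the pigeons from the closure … to holes
injectively"], here: systems `F` of rank `≤ n/4 + 1` with a block closure `(Q, p)` (tree:
`exists_blockClosure`, the pivot form of EGI24's closure with the size bound `|Q| + 1 ≤ rk F`) and a
solution `σ` placing the pigeons of `Q` in pairwise distinct holes, is a `(n/4 + 1)`-RANK-winning
strategy (`ResLinRankStrategy.lean`): (2) a clause on pigeons `x ≠ y` is satisfied by `σ` unless
both sit in the same hole, in which case one of them, say `x`, is outside `Q` and flipping one of
its non-pivot bits `j₀ ∉ {p x, p y}` (possible for `ℓ ≥ 3`) inside the solutions of `F` separates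
them (EGI24 Lemma 5.7); (3) consequences keep closure and witness (`BlockFree.mono`,
`linFormVec_mem_span_of_imp`; EGI24 Prop. 5.1); (4) for a new form `f` take a closure `(Q', p')` of
`L(F) ∪ {f}`, `|Q'| ≤ n/4`, and RE-PLACE the new pigeons `Q' ∖ Q` by choosing their non-pivot
(w.r.t. the OLD pivots) bit patterns greedily so that each differs from every kept hole of
`Q ∩ Q'` at a non-pivot position and from every other new pattern at a position that is a pivot
of neither (`exists_separated_patterns`: at most `|Q ∩ Q'| + 2|Q' ∖ Q| ≤ 2|Q'| ≤ n/2 = 2^(ℓ-1)`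
patterns are ever forbidden); whatever the uncontrolled pivot bits turn out to be, the holes of
`Q'` are then pairwise distinct. This replaces the probabilistic Lemma 5.4 of the paper (random
solutions, `6t²/n`); the bound obtained is the printed `n/4`. Then Lemma 3.3 of Alekseev–Itsykson
(`IsRankWinningStrategy.lt_resLinWidth`).

NOT here: the regular / bounded-depth Res(⊕) SIZE lower bounds for `BPHP` (EGI24 Thm 8.1, Byramji–
Impagliazzo 2025), the tree-like bound `2^{n/4}` as printed (Thm 5.8; the tree's tree-like law gives
`2^{n/4 - 2ℓ}` from the rank bound, see the Summits corollary), unsatisfiability of `bphpCNF`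
for `m > 2^ℓ` (not needed for the rank statement).

## References

* K. Efremenko, M. Garlík, D. Itsykson, *Lower bounds for regular resolution over parities*,
  STOC 2024 (SIAM J. Comput. 2025), §2.5 (`BPHP`), §5 (locally consistent systems, Prop. 5.1,
  Lemmas 5.3–5.4, Thm 5.5, Lemma 5.7, Thm 5.8) [EfremenkoGarlikItsykson2024].
* Y. Alekseev, D. Itsykson, STOC 2025, Lemma 3.3 [AlekseevItsykson2025].
-/

namespace Literature.Computability.MetaComplexity

open _root_.Computability Complexity Finset

/-! ### The binary pigeonhole principle -/

/-- The clause "pigeon `x` does not sit in the hole `S ⊆ [ℓ]`" (bit `j` of the hole is `[j ∈ S]`):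
`⋁_{j<ℓ} (x_{x,j} ≠ [j ∈ S])`, i.e. the literals `(x·ℓ + j, ¬[j ∈ S])`.
[Efremenko–Garlík–Itsykson 2024, §2.5] [cite: EfremenkoGarlikItsykson2024, §2.5] -/
def bphpBlockClause (ℓ x : ℕ) (S : List (Fin ℓ)) : Clause ℕ :=
  (List.finRange ℓ).map fun j : Fin ℓ => (x * ℓ + j.val, !decide (j ∈ S))

/-- **The binary pigeonhole principle `BPHPᵐ_{2^ℓ}`**: `m` pigeons, pigeon `x` described by the
`ℓ` bits `x·ℓ + j` of its hole; for all pigeons `x < y < m` and every hole `S ⊆ [ℓ]` the clause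
"`x` is not in `S` or `y` is not in `S`". Unsatisfiable for `m > 2^ℓ` (`bphpCNF_not_satisfiable` in
`BinaryPigeonholeUnsat.lean`).
[Efremenko–Garlík–Itsykson 2024, §2.5] [cite: EfremenkoGarlikItsykson2024, §2.5] -/
def bphpCNF (m ℓ : ℕ) : CNF ℕ :=
  (List.finRange m).flatMap fun y : Fin m => (List.finRange m).flatMap fun x : Fin m =>
    if x.val < y.val then
      ((List.finRange ℓ).sublists).map fun S => bphpBlockClause ℓ x.val S ++ bphpBlockClause ℓ y.val S
    else []

/-- The hole of pigeon `x` under the assignment `σ`: its `ℓ` bits. [Efremenko–Garlík–Itsykson 2024,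
§2.5 (the map `σ̄`)] [cite: EfremenkoGarlikItsykson2024, §2.5] -/
def holeOf (ℓ : ℕ) (σ : ℕ → Bool) (x : ℕ) : Fin ℓ → Bool := fun j => σ (x * ℓ + j)

/-- Every clause of `BPHP` is the clause of two distinct pigeons and one hole. [folklore] -/
theorem exists_of_mem_bphpCNF {m ℓ : ℕ} {c : Clause ℕ} (hc : c ∈ bphpCNF m ℓ) :
    ∃ x y : ℕ, x ≠ y ∧ ∃ S : List (Fin ℓ), c = bphpBlockClause ℓ x S ++ bphpBlockClause ℓ y S := by
  unfold bphpCNF at hc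
  simp only [List.mem_flatMap, List.mem_finRange, true_and] at hc
  obtain ⟨y, x, hc⟩ := hc
  by_cases hxy : x.val < y.val
  · rw [if_pos hxy] at hc
    obtain ⟨S, -, rfl⟩ := List.mem_map.1 hc
    exact ⟨x.val, y.val, Nat.ne_of_lt hxy, S, rfl⟩
  · rw [if_neg hxy] at hc
    simp at hc

/-- `BPHPᵐ_{2^ℓ}` is a `2ℓ`-CNF. [Efremenko–Garlík–Itsykson 2024, §2.5] [cite: EfremenkoGarlikItsykson2024, §2.5] -/
theorem isWidthLE_bphpCNF (m ℓ : ℕ) : (bphpCNF m ℓ).IsWidthLE (2 * ℓ) := by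
  intro c hc
  obtain ⟨x, y, -, S, rfl⟩ := exists_of_mem_bphpCNF hc
  simp [bphpBlockClause]
  omega

/-- Two pigeons in different holes satisfy every clause about them. [Efremenko–Garlík–Itsykson 2024,
Lemma 5.7 (proof)] [cite: EfremenkoGarlikItsykson2024, Lemma 5.7] -/
theorem eval_bphpClause_of_holeOf_ne {ℓ x y : ℕ} {σ : ℕ → Bool} (h : holeOf ℓ σ x ≠ holeOf ℓ σ y)
    (S : List (Fin ℓ)) :
    (Clause.toLinClause (bphpBlockClause ℓ x S ++ bphpBlockClause ℓ y S)).eval σ = true := by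
  rw [eval_toLinClause]
  by_contra hne
  apply h
  funext j
  have hall : ∀ l ∈ bphpBlockClause ℓ x S ++ bphpBlockClause ℓ y S, ¬ Literal.eval σ l = true := by
    have : (bphpBlockClause ℓ x S ++ bphpBlockClause ℓ y S).any (Literal.eval σ) = false := by
      revert hne; cases (bphpBlockClause ℓ x S ++ bphpBlockClause ℓ y S).any (Literal.eval σ) <;> simp
    exact List.any_eq_false.1 this
  have hx := hall (x * ℓ + j.val, !decide (j ∈ S))
    (List.mem_append_left _ (List.mem_map.2 ⟨j, List.mem_finRange j, rfl⟩))
  have hy := hall (y * ℓ + j.val, !decide (j ∈ S))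
    (List.mem_append_right _ (List.mem_map.2 ⟨j, List.mem_finRange j, rfl⟩))
  simp only [Literal.eval] at hx hy
  show σ (x * ℓ + j) = σ (y * ℓ + j)
  revert hx hy
  cases σ (x * ℓ + j) <;> cases σ (y * ℓ + j) <;> cases decide (j ∈ S) <;> simp

/-! ### Greedy choice of separated bit patterns -/

/-- **Separated patterns.** Given pivots `p`, a finite set `C` of kept pigeons with holes `u`, and a
finite set `T` of new pigeons with `|C| + 2|T| ≤ 2^(ℓ-1)` (`ℓ ≥ 1`), there are patterns `t e`
(`e ∈ T`) such that every `t e` differs from every kept hole `u q` at a position `≠ p e`, and every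
two patterns `t e, t e'` (`e ≠ e'`) differ at a position which is a pivot of neither. (Greedy: a new
pigeon sees at most `2|C| + 4|T|  < 2^ℓ` forbidden patterns among all `2^ℓ`.)
[Efremenko–Garlík–Itsykson 2024, §5 (Lemma 5.4, here derandomised)] [cite: EfremenkoGarlikItsykson2024, Lemma 5.4] -/
theorem exists_separated_patterns {ℓ : ℕ} (hℓ : 1 ≤ ℓ) (p : ℕ → Fin ℓ) (C : Finset ℕ)
    (u : ℕ → Fin ℓ → Bool) :
    ∀ T : Finset ℕ, C.card + 2 * T.card ≤ 2 ^ (ℓ - 1) →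
      ∃ t : ℕ → Fin ℓ → Bool,
        (∀ e ∈ T, ∀ q ∈ C, ∃ j : Fin ℓ, j ≠ p e ∧ t e j ≠ u q j) ∧
        (∀ e ∈ T, ∀ e' ∈ T, e ≠ e' → ∃ j : Fin ℓ, j ≠ p e ∧ j ≠ p e' ∧ t e j ≠ t e' j) := by
  classical
  intro T
  induction T using Finset.induction_on with
  | empty => intro _; exact ⟨fun _ _ => false, by simp, by simp⟩
  | insert e T₀ heT₀ ih =>
    intro hcard
    rw [Finset.card_insert_of_notMem heT₀] at hcard
    obtain ⟨t₀, h1, h2⟩ := ih (by omega)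
    -- the forbidden patterns for the new pigeon `e`
    let badC : Finset (Fin ℓ → Bool) :=
      C.biUnion fun q => Finset.univ.filter fun v => ∀ j : Fin ℓ, j ≠ p e → v j = u q j
    let badT : Finset (Fin ℓ → Bool) :=
      T₀.biUnion fun e' => Finset.univ.filter fun v => ∀ j : Fin ℓ, j ≠ p e → j ≠ p e' → v j = t₀ e' j
    have hbadC : badC.card ≤ 2 * C.card := by
      refine (Finset.card_biUnion_le).trans ?_
      rw [mul_comm, ← smul_eq_mul, ← Finset.sum_const]
      refine Finset.sum_le_sum fun q _ => ?_
      -- such patterns are determined by their bit at `p e`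
      have hinj : Set.InjOn (fun v : Fin ℓ → Bool => v (p e))
          (Finset.univ.filter fun v : Fin ℓ → Bool => ∀ j : Fin ℓ, j ≠ p e → v j = u q j) := by
        intro v hv v' hv' hvv
        simp only [Finset.coe_filter, Finset.mem_univ, true_and, Set.mem_setOf_eq] at hv hv'
        funext j
        by_cases hj : j = p e
        · subst hj; exact hvv
        · rw [hv j hj, hv' j hj]
      calc _ ≤ (Finset.univ : Finset Bool).card :=
            Finset.card_le_card_of_injOn _ (fun _ _ => Finset.mem_univ _) hinj
        _ = 2 := by simp
    have hbadT : badT.card ≤ 4 * T₀.card := by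
      refine (Finset.card_biUnion_le).trans ?_
      rw [mul_comm, ← smul_eq_mul, ← Finset.sum_const]
      refine Finset.sum_le_sum fun e' _ => ?_
      have hinj : Set.InjOn (fun v : Fin ℓ → Bool => (v (p e), v (p e')))
          (Finset.univ.filter fun v : Fin ℓ → Bool =>
            ∀ j : Fin ℓ, j ≠ p e → j ≠ p e' → v j = t₀ e' j) := by
        intro v hv v' hv' hvv
        simp only [Finset.coe_filter, Finset.mem_univ, true_and, Set.mem_setOf_eq] at hv hv'
        simp only [Prod.mk.injEq] at hvv
        funext j
        by_cases hj : j = p e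
        · subst hj; exact hvv.1
        · by_cases hj' : j = p e'
          · subst hj'; exact hvv.2
          · rw [hv j hj hj', hv' j hj hj']
      calc _ ≤ (Finset.univ : Finset (Bool × Bool)).card :=
            Finset.card_le_card_of_injOn _ (fun _ _ => Finset.mem_univ _) hinj
        _ = 4 := by simp
    -- there is a pattern outside the forbidden ones
    have hlt : (badC ∪ badT).card < (Finset.univ : Finset (Fin ℓ → Bool)).card := by
      have hpow : (2 : ℕ) ^ ℓ = 2 * 2 ^ (ℓ - 1) := by
        rw [← pow_succ']; congr 1; omega
      rw [Finset.card_univ, Fintype.card_fun, Fintype.card_bool, Fintype.card_fin, hpow]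
      refine (Finset.card_union_le _ _).trans_lt ?_
      omega
    obtain ⟨v, -, hv⟩ := Finset.exists_mem_notMem_of_card_lt_card hlt
    rw [Finset.mem_union, not_or] at hv
    obtain ⟨hvC, hvT⟩ := hv
    have hvC' : ∀ q ∈ C, ∃ j : Fin ℓ, j ≠ p e ∧ v j ≠ u q j := by
      intro q hq
      by_contra hne
      push Not at hne
      exact hvC (Finset.mem_biUnion.2 ⟨q, hq, Finset.mem_filter.2 ⟨Finset.mem_univ _, hne⟩⟩)
    have hvT' : ∀ e' ∈ T₀, ∃ j : Fin ℓ, j ≠ p e ∧ j ≠ p e' ∧ v j ≠ t₀ e' j := by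
      intro e' he'
      by_contra hne
      push Not at hne
      exact hvT (Finset.mem_biUnion.2 ⟨e', he', Finset.mem_filter.2 ⟨Finset.mem_univ _, hne⟩⟩)
    -- extend the choice
    refine ⟨Function.update t₀ e v, ?_, ?_⟩
    · intro x hx q hq
      by_cases hxe : x = e
      · rw [hxe, Function.update_self]; exact hvC' q hq
      · have hxT : x ∈ T₀ := (Finset.mem_insert.1 hx).resolve_left hxe
        rw [Function.update_of_ne hxe]; exact h1 x hxT q hq
    · intro x hx x' hx' hxx'
      by_cases hxe : x = e
      · rw [hxe] at hxx' ⊢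
        have hx'e : x' ≠ e := fun h => hxx' h.symm
        have hx'T : x' ∈ T₀ := (Finset.mem_insert.1 hx').resolve_left hx'e
        rw [Function.update_self, Function.update_of_ne hx'e]
        exact hvT' x' hx'T
      · have hxT : x ∈ T₀ := (Finset.mem_insert.1 hx).resolve_left hxe
        rw [Function.update_of_ne hxe]
        by_cases hx'e : x' = e
        · rw [hx'e, Function.update_self]
          obtain ⟨j, hj1, hj2, hj3⟩ := hvT' x hxT
          exact ⟨j, hj2, hj1, fun h => hj3 h.symm⟩
        · have hx'T : x' ∈ T₀ := (Finset.mem_insert.1 hx').resolve_left hx'e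
          rw [Function.update_of_ne hx'e]
          exact h2 x hxT x' hx'T hxx'

/-! ### Locally consistent systems (the rank strategy for `BPHP`) -/

/-- **Locally consistent systems** [Efremenko–Garlík–Itsykson 2024, §5, with an existential closure]:
the systems `F` of rank `≤ K` with a block closure `(Q, p)` (`BlockFree`) and a solution `σ` whose
pigeons of `Q` sit in pairwise distinct holes. [cite: EfremenkoGarlikItsykson2024, §5 (locally consistent systems)] -/
def bphpFamily (ℓ K : ℕ) : Set (Finset LinLit) :=
  {F | linClauseRank F ≤ K ∧ ∃ Q : Finset ℕ, ∃ p : ℕ → Fin ℓ, ∃ σ : ℕ → Bool,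
    BlockFree ℓ F Q p ∧ (∀ e ∈ F, LinLit.eval σ e = true) ∧ Set.InjOn (holeOf ℓ σ) Q}

section Strategy

variable {ℓ m : ℕ}

/-- The block of the variable `x·ℓ + j` is `x`. [folklore] -/
theorem div_block_eq {ℓ x j : ℕ} (hℓ : 0 < ℓ) (hj : j < ℓ) : (x * ℓ + j) / ℓ = x := by
  rw [Nat.add_comm, Nat.add_mul_div_right _ _ hℓ, Nat.div_eq_of_lt hj, zero_add]

/-- The position of the variable `x·ℓ + j` is `j`. [folklore] -/
theorem mod_block_eq {ℓ x j : ℕ} (hj : j < ℓ) : (x * ℓ + j) % ℓ = j := by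
  rw [Nat.add_comm, Nat.add_mul_mod_self_right, Nat.mod_eq_of_lt hj]

/-- The empty system is locally consistent. [Efremenko–Garlík–Itsykson 2024, §5 (example 1)]
[cite: EfremenkoGarlikItsykson2024, §5 (locally consistent systems)] -/
theorem empty_mem_bphpFamily (hℓ : 0 < ℓ) (K : ℕ) : (∅ : Finset LinLit) ∈ bphpFamily ℓ K := by
  obtain ⟨Q, hQ, p, hfree⟩ := exists_blockClosure hℓ (∅ : Finset LinLit)
  have hQ0 : Q = ∅ := by
    rcases hQ with h | h
    · exact h
    · simp at h
  subst hQ0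
  exact ⟨by simp, ∅, p, fun _ => false, hfree, by simp, by simp⟩

/-- **Separating two pigeons in the same hole** [Efremenko–Garlík–Itsykson 2024, Lemma 5.7]: if
pigeon `x` is outside the closure `Q` of `F`, then `F` has a solution in which `x` and `y` sit in
different holes — flip a bit of `x` at a position which is a pivot of neither (`ℓ ≥ 3`).
[cite: EfremenkoGarlikItsykson2024, Lemma 5.7] -/
theorem exists_sol_holeOf_ne (hℓ : 3 ≤ ℓ) {F : Finset LinLit} {Q : Finset ℕ} {p : ℕ → Fin ℓ}
    (hfree : BlockFree ℓ F Q p) {σ : ℕ → Bool} (hσ : ∀ e ∈ F, LinLit.eval σ e = true)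
    {x y : ℕ} (hxy : x ≠ y) (hx : x ∉ Q) :
    ∃ σ' : ℕ → Bool, (∀ e ∈ F, LinLit.eval σ' e = true) ∧ holeOf ℓ σ' x ≠ holeOf ℓ σ' y := by
  classical
  by_cases hne : holeOf ℓ σ x ≠ holeOf ℓ σ y
  · exact ⟨σ, hσ, hne⟩
  push Not at hne
  -- a position that is a pivot of neither pigeon
  obtain ⟨j₀, hj₀x, hj₀y⟩ : ∃ j₀ : Fin ℓ, j₀ ≠ p x ∧ j₀ ≠ p y := by
    have hlt : ({p x, p y} : Finset (Fin ℓ)).card < (Finset.univ : Finset (Fin ℓ)).card := by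
      rw [Finset.card_univ, Fintype.card_fin]
      exact (Finset.card_insert_le _ _).trans_lt (by simp; omega)
    obtain ⟨j₀, -, hj₀⟩ := Finset.exists_mem_notMem_of_card_lt_card hlt
    simp only [Finset.mem_insert, Finset.mem_singleton, not_or] at hj₀
    exact ⟨j₀, hj₀.1, hj₀.2⟩
  -- flip bit `j₀` of pigeon `x`
  let τ : ℕ → Bool := Function.update σ (x * ℓ + j₀) (!σ (x * ℓ + j₀))
  obtain ⟨σ', hforms, hQ, hout⟩ := hfree σ τ
  refine ⟨σ', solves_of_forms_eq hforms hσ, fun heq => ?_⟩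
  have hxj : σ' (x * ℓ + j₀) = !σ (x * ℓ + j₀) := by
    rw [hout x hx j₀ hj₀x]; simp [τ]
  have hyj : σ' (y * ℓ + j₀) = σ (y * ℓ + j₀) := by
    by_cases hy : y ∈ Q
    · exact hQ y hy j₀
    · rw [hout y hy j₀ hj₀y]
      have hne' : y * ℓ + (j₀ : ℕ) ≠ x * ℓ + j₀ := by
        intro h
        have := congrArg (· / ℓ) h
        simp only [div_block_eq (by omega : 0 < ℓ) j₀.isLt] at this
        exact hxy this.symm
      simp [τ, Function.update_of_ne hne']
  have h1 : σ' (x * ℓ + j₀) = σ' (y * ℓ + j₀) := congrFun heq j₀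
  have h2 : σ (x * ℓ + j₀) = σ (y * ℓ + j₀) := congrFun hne j₀
  rw [hxj, hyj, ← h2] at h1
  revert h1; cases σ (x * ℓ + j₀) <;> simp

/-- Property (2): every clause of `BPHP` is satisfied by some solution of every locally consistent
system. [Efremenko–Garlík–Itsykson 2024, Lemma 5.7] [cite: EfremenkoGarlikItsykson2024, Lemma 5.7] -/
theorem bphpFamily_exists_sat (hℓ : 3 ≤ ℓ) {K : ℕ} {F : Finset LinLit} (hF : F ∈ bphpFamily ℓ K)
    {c : Clause ℕ} (hc : c ∈ bphpCNF m ℓ) :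
    ∃ σ : ℕ → Bool, (∀ e ∈ F, LinLit.eval σ e = true) ∧ (Clause.toLinClause c).eval σ = true := by
  obtain ⟨-, Q, p, σ, hfree, hσ, hinj⟩ := hF
  obtain ⟨x, y, hxy, S, rfl⟩ := exists_of_mem_bphpCNF hc
  by_cases hx : x ∈ Q
  · by_cases hy : y ∈ Q
    · -- both in the closure: already in distinct holes
      refine ⟨σ, hσ, eval_bphpClause_of_holeOf_ne (fun h => hxy (hinj hx hy h)) S⟩
    · obtain ⟨σ', hσ', hne⟩ := exists_sol_holeOf_ne hℓ hfree hσ (Ne.symm hxy) hy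
      exact ⟨σ', hσ', eval_bphpClause_of_holeOf_ne (Ne.symm hne) S⟩
  · obtain ⟨σ', hσ', hne⟩ := exists_sol_holeOf_ne hℓ hfree hσ hxy hx
    exact ⟨σ', hσ', eval_bphpClause_of_holeOf_ne hne S⟩

/-- Property (3): locally consistent systems are closed under semantic consequences of rank `≤ K`.
[Efremenko–Garlík–Itsykson 2024, Prop. 5.1] [cite: EfremenkoGarlikItsykson2024, Prop. 5.1] -/
theorem bphpFamily_mem_of_imp {K : ℕ} {F : Finset LinLit} (hF : F ∈ bphpFamily ℓ K)
    (G : Finset LinLit)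
    (himp : ∀ σ : ℕ → Bool, (∀ e ∈ F, LinLit.eval σ e = true) → ∀ e ∈ G, LinLit.eval σ e = true)
    (hG : linClauseRank G ≤ K) : G ∈ bphpFamily ℓ K := by
  obtain ⟨-, Q, p, σ, hfree, hσ, hinj⟩ := hF
  refine ⟨hG, Q, p, σ, ?_, himp σ hσ, hinj⟩
  refine hfree.mono fun e he => ?_
  exact linFormVec_mem_span_of_imp hσ (b := e.2) fun σ₁ hσ₁ => by
    rw [Prod.mk.eta]; exact himp σ₁ hσ₁ e he

/-- Property (4), the extension step with RE-PLACEMENT [Efremenko–Garlík–Itsykson 2024, §5, Lemmas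
5.3–5.4 derandomised]: below rank `2^(ℓ-2) + 1` every locally consistent system extends by any
linear form. Take a closure `(Q', p')` of `L(F) ∪ {f}` (`|Q'| ≤ 2^(ℓ-2)`), choose separated
non-pivot patterns for the pigeons of `Q' ∖ Q` (`exists_separated_patterns`), realise them inside
the solutions of `F` by the freeness of the OLD closure, and answer `f` by its value there.
[cite: EfremenkoGarlikItsykson2024, Theorem 5.5 (proof)] -/
theorem bphpFamily_exists_insert_mem (hℓ : 3 ≤ ℓ) {F : Finset LinLit}
    (hF : F ∈ bphpFamily ℓ (2 ^ (ℓ - 2) + 1)) (hrank : linClauseRank F < 2 ^ (ℓ - 2) + 1)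
    (f : Finset ℕ) : ∃ c : Bool, insert (f, c) F ∈ bphpFamily ℓ (2 ^ (ℓ - 2) + 1) := by
  classical
  have hℓ0 : 0 < ℓ := by omega
  obtain ⟨-, Q, p, σ, hfree, hσ, hinj⟩ := hF
  -- a closure of `L(F) ∪ {f}`
  obtain ⟨Q', hQ'size, p', hfree'⟩ := exists_blockClosure hℓ0 (insert (f, false) F)
  have hQ'card : Q'.card ≤ 2 ^ (ℓ - 2) := by
    rcases hQ'size with h | h
    · rw [h, Finset.card_empty]; exact Nat.zero_le _
    · have := linClauseRank_insert_le (f, false) F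
      omega
  -- separated patterns for the new pigeons
  set C : Finset ℕ := Q ∩ Q' with hCdef
  set T : Finset ℕ := Q' \ Q with hTdef
  have hCT : C.card + 2 * T.card ≤ 2 ^ (ℓ - 1) := by
    have h1 : C.card + T.card = Q'.card := by
      rw [hCdef, hTdef, Finset.inter_comm, ← Finset.card_union_of_disjoint (Finset.disjoint_sdiff_inter Q' Q |>.symm)]
      · congr 1
        rw [Finset.union_comm, Finset.sdiff_union_inter]
    have h2 : (2 : ℕ) ^ (ℓ - 1) = 2 * 2 ^ (ℓ - 2) := by
      rw [← pow_succ']; congr 1; omega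
    have h3 : T.card ≤ Q'.card := Finset.card_le_card Finset.sdiff_subset
    omega
  obtain ⟨t, htC, htT⟩ := exists_separated_patterns (by omega) p C (holeOf ℓ σ) T hCT
  -- the targets: the chosen patterns on the blocks of `T`
  let τ : ℕ → Bool := fun v =>
    if v / ℓ ∈ T then t (v / ℓ) ⟨v % ℓ, Nat.mod_lt v hℓ0⟩ else σ v
  have hτ : ∀ x ∈ T, ∀ j : Fin ℓ, τ (x * ℓ + j) = t x j := by
    intro x hx j
    simp only [τ, div_block_eq hℓ0 j.isLt, hx, if_true]
    congr 1
    exact Fin.ext (mod_block_eq j.isLt)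
  obtain ⟨σ', hforms, hQblocks, hout⟩ := hfree σ τ
  have hσ'F : ∀ e ∈ F, LinLit.eval σ' e = true := solves_of_forms_eq hforms hσ
  -- holes after the move
  have hkept : ∀ q ∈ Q, holeOf ℓ σ' q = holeOf ℓ σ q := by
    intro q hq; funext j; exact hQblocks q hq j
  have hnew : ∀ x ∈ T, ∀ j : Fin ℓ, j ≠ p x → holeOf ℓ σ' x j = t x j := by
    intro x hx j hj
    have hxQ : x ∉ Q := (Finset.mem_sdiff.1 hx).2
    show σ' (x * ℓ + j) = t x j
    rw [hout x hxQ j hj, hτ x hx j]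
  -- the pigeons of `Q'` sit in pairwise distinct holes
  have hinj' : Set.InjOn (holeOf ℓ σ') Q' := by
    intro q₁ hq₁ q₂ hq₂ heq
    by_contra hne
    have hcase : ∀ q, q ∈ (Q' : Set ℕ) → q ∈ C ∨ q ∈ T := by
      intro q hq
      by_cases hqQ : q ∈ Q
      · exact Or.inl (Finset.mem_inter.2 ⟨hqQ, hq⟩)
      · exact Or.inr (Finset.mem_sdiff.2 ⟨hq, hqQ⟩)
    have hCQ : ∀ q ∈ C, q ∈ Q := fun q hq => (Finset.mem_inter.1 hq).1
    rcases hcase q₁ hq₁ with h₁ | h₁ <;> rcases hcase q₂ hq₂ with h₂ | h₂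
    · -- both kept: injectivity of the old placement
      rw [hkept q₁ (hCQ q₁ h₁), hkept q₂ (hCQ q₂ h₂)] at heq
      exact hne (hinj (hCQ q₁ h₁) (hCQ q₂ h₂) heq)
    · -- kept vs new
      obtain ⟨j, hj, hne'⟩ := htC q₂ h₂ q₁ h₁
      apply hne'
      rw [← hnew q₂ h₂ j hj, ← heq, hkept q₁ (hCQ q₁ h₁)]
    · obtain ⟨j, hj, hne'⟩ := htC q₁ h₁ q₂ h₂
      apply hne'
      rw [← hnew q₁ h₁ j hj, heq, hkept q₂ (hCQ q₂ h₂)]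
    · -- both new
      obtain ⟨j, hj₁, hj₂, hne'⟩ := htT q₁ h₁ q₂ h₂ hne
      apply hne'
      rw [← hnew q₁ h₁ j hj₁, ← hnew q₂ h₂ j hj₂, heq]
  -- answer `f` by its value at `σ'`
  refine ⟨LinLit.eval σ' (f, true), ?_, Q', p', σ', ?_, ?_, hinj'⟩
  · exact (linClauseRank_insert_le _ _).trans (by omega)
  · refine hfree'.mono fun e he => Submodule.subset_span ?_
    rcases Finset.mem_insert.1 he with rfl | he
    · exact LinClause.mem_forms_iff.2 ⟨(f, false), Finset.mem_insert_self _ _, rfl⟩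
    · exact LinClause.mem_forms_iff.2 ⟨e, Finset.mem_insert_of_mem he, rfl⟩
  · intro e he
    rcases Finset.mem_insert.1 he with rfl | he
    · cases h : LinLit.eval σ' (f, true)
      · have h1 := LinLit.eval_true_eq_not σ' f
        rw [h] at h1
        revert h1
        cases LinLit.eval σ' (f, false) <;> simp
      · exact h
    · exact hσ'F e he

/-- **Locally consistent systems form a `(n/4 + 1)`-rank-winning strategy for `BPHPᵐₙ`**, `n = 2^ℓ`,
`ℓ ≥ 3`. [Efremenko–Garlík–Itsykson 2024, §5 (proof of Thm 5.5)] [cite: EfremenkoGarlikItsykson2024, Theorem 5.5] -/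
theorem isRankWinningStrategy_bphpFamily (hℓ : 3 ≤ ℓ) (m : ℕ) :
    IsRankWinningStrategy (bphpCNF m ℓ) (2 ^ (ℓ - 2) + 1) (bphpFamily ℓ (2 ^ (ℓ - 2) + 1)) where
  nonempty := ⟨∅, empty_mem_bphpFamily (by omega) _⟩
  rank_le _ hF := hF.1
  exists_sat _ hF _ hc := bphpFamily_exists_sat hℓ hF hc
  mem_of_imp _ hF G himp hG := bphpFamily_mem_of_imp hF G himp hG
  exists_insert_mem _ hF hrank f := bphpFamily_exists_insert_mem hℓ hF hrank f

end Strategy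

/-! ### The rank lower bound -/

/-- **Efremenko–Garlík–Itsykson 2024, Theorem 5.5 (Res(⊕) rank of the binary pigeonhole principle).**
For `ℓ ≥ 3` and every `m`, every Res(⊕) refutation (resolution rule + semantic weakening) of
`BPHPᵐ_{2^ℓ} = bphpCNF m ℓ` contains a linear clause `C` with `rk(¬C) = linClauseRank C > 2^(ℓ-2)`,
i.e. rank `> n/4` for `n = 2^ℓ` holes. (Printed: `rk(¬C) ≥ n/4`; the extension step here is
deterministic.) [cite: EfremenkoGarlikItsykson2024, Theorem 5.5] -/
theorem lt_resLinWidth_bphp {ℓ : ℕ} (hℓ : 3 ≤ ℓ) (m : ℕ) {π : List ResLinLine}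
    (hπ : IsResLinRefutation (bphpCNF m ℓ) π) : 2 ^ (ℓ - 2) < resLinWidth π :=
  (isRankWinningStrategy_bphpFamily hℓ m).lt_resLinWidth hπ

/-- Pointwise form: some line of every Res(⊕) refutation of `BPHPᵐ_{2^ℓ}` has rank `> 2^(ℓ-2)`.
[cite: EfremenkoGarlikItsykson2024, Theorem 5.5] -/
theorem exists_lt_linClauseRank_bphp {ℓ : ℕ} (hℓ : 3 ≤ ℓ) (m : ℕ) {π : List ResLinLine}
    (hπ : IsResLinRefutation (bphpCNF m ℓ) π) : ∃ l ∈ π, 2 ^ (ℓ - 2) < linClauseRank l.clause :=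
  lt_resLinWidth_iff.1 (lt_resLinWidth_bphp hℓ m hπ)

/-- `ℕ∞` form: `minResLinWidth (bphpCNF m ℓ) ≥ 2^(ℓ-2) + 1` (`ℓ ≥ 3`).
[cite: EfremenkoGarlikItsykson2024, Theorem 5.5] -/
theorem le_minResLinWidth_bphp {ℓ : ℕ} (hℓ : 3 ≤ ℓ) (m : ℕ) :
    ((2 ^ (ℓ - 2) + 1 : ℕ) : ℕ∞) ≤ minResLinWidth (bphpCNF m ℓ) := by
  unfold minResLinWidth
  refine le_iInf₂ fun π hπ => ?_
  exact_mod_cast lt_resLinWidth_bphp hℓ m hπ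

end Literature.Computability.MetaComplexity
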